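import Mathlib
import Literature.Computability.AlgebraicComplexity.RealTauKnownCases

/-!
# `MatrixDescartes` (stmt-ValiantsHypothesis-18050), line «definite-pair-fold-law» — first rung `stub_rungOne`

The ideator line `Cruxes/MatrixDescartes/Lines/definite_pair_fold_law.lean` (val-idea-2 g2, 2026-08-28) grades the
hypothesis class of Conjecture B by the {p : Fin 2 → ℝ | 0 < p 0 ∧ 0 < p 1 ∧ MvPolynomial.eval p
          (∑ l, (MvPolynomial.X (0 : Fin 2) : MvPolynomial (Fin 2) ℝ) ^ d l •
          ((P l).map (MvPolynomial.C : ℝ →+* MvPolynomial (Fin 2) ℝ)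
            - (MvPolynomial.X (1 : Fin 2) : MvPolynomial (Fin 2) ℝ) •
              (Q l).map (MvPolynomial.C : ℝ →+* MvPolynomial (Fin 2) ℝ))).det = 0 ∧
        MvPolynomial.eval p (MvPolynomial.X 0 * MvPolynomial.pderiv 0
          (∑ l, (MvPolynomial.X (0 : Fin 2) : MvPolynomial (Fin 2) ℝ) ^ d l •
          ((P l).map (MvPolynomial.C : ℝ →+* MvPolynomial (Fin 2) ℝ)
            - (MvPolynomial.X (1 : Fin 2) : MvPolynomial (Fin 2) ℝ) •
              (Q l).map (MvPolynomial.C : ℝ →+* MvPolynomial (Fin 2) ℝ))).det) = 0} NUMBER `κ(A, C)` of the spectral curve of a definite pair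
`(A(x), C(x)) = (Σ_l x^{d_l} P_l, Σ_l x^{d_l} Q_l)`: the number of points `(x, y)`, `x, y > 0`, with
`Φ(x,y) = det(A(x) − y C(x)) = 0` and `θ_x Φ(x,y) = 0`.  Its declared FIRST RUNG is the `1 × 1` case

  `stub_rungOne : ∀ K, FoldLawAt 1 K (K ^ 2)`.

For scalar letters `Φ = a(x) − y·c(x)`; a fold point satisfies `y = a(x)/c(x)` and `W(x) = 0` for the Wronskian
`W = θa·c − a·θc = Σ_{i,j} (d_i − d_j) p_i q_j x^{d_i + d_j}` (at most `K²` monomials), so `(x,y) ↦ x` maps the fold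
set injectively into the positive zeros of `W`; sparse Descartes
(`Literature.Computability.AlgebraicComplexity.card_roots_toFinset_filter_pos_lt_card_support`) bounds those by
`#supp W − 1 < K²` when `W ≠ 0`, and when `W = 0` every `(x, a(x)/c(x))`, `x > 0`, is a fold point, so the fold
set is infinite and the finiteness hypothesis of `FoldLawAt` is violated.

`stub_rungOne` below is the line's statement with `FoldLawAt` / `IsDefinitePair` / `SimpleSpectrum` / `foldSet` /
`euler` / `pairPoly` UN{p : Fin 2 → ℝ | 0 < p 0 ∧ 0 < p 1 ∧ MvPolynomial.eval p
          (∑ l, (MvPolynomial.X (0 : Fin 2) : MvPolynomial (Fin 2) ℝ) ^ d l •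
          ((P l).map (MvPolynomial.C : ℝ →+* MvPolynomial (Fin 2) ℝ)
            - (MvPolynomial.X (1 : Fin 2) : MvPolynomial (Fin 2) ℝ) •
              (Q l).map (MvPolynomial.C : ℝ →+* MvPolynomial (Fin 2) ℝ))).det = 0 ∧
        MvPolynomial.eval p (MvPolynomial.X 0 * MvPolynomial.pderiv 0
          (∑ l, (MvPolynomial.X (0 : Fin 2) : MvPolynomial (Fin 2) ℝ) ^ d l •
          ((P l).map (MvPolynomial.C : ℝ →+* MvPolynomial (Fin 2) ℝ)
            - (MvPolynomial.X (1 : Fin 2) : MvPolynomial (Fin 2) ℝ) •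
              (Q l).map (MvPolynomial.C : ℝ →+* MvPolynomial (Fin 2) ℝ))).det) = 0}ED (no definitions are introduced here), so the skeleton's `sorry` closes by
`exact FoldLaw.stub_rungOne` (δ-unfolding; checked against a verbatim copy of the line's vocabulary).  The
hypothesis `SimpleSpectrum` is not used at `m = 1` (it follows from definiteness).

Helper mode (`--supports stmt-ValiantsHypothesis-18050 --as helper`): the line is not registered on the item.
Honest framing: the `m = 1` rung is Descartes' rule; the law `stub_foldLaw`, Conjecture B (`KPlusLogSqLaw`), the
crux `MatrixDescartes` and VP ≠ VNP are OPEN and NOT moved by this file.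
-/

set_option linter.dupNamespace false

namespace Summit.ValiantsHypothesis.ValiantsHypothesis.Theorems.LacunarySymmetroidMatrixDescartes.FoldLaw

open Polynomial Matrix
open scoped BigOperators

section RungOne

variable {K : ℕ} (d : Fin K → ℕ) (P Q : Fin K → Matrix (Fin 1) (Fin 1) ℝ)

/-- For scalar letters the line's pair polynomial `pairPoly d P Q` is `Σ_l X₀^{d_l} (p_l − X₁ q_l)`. -/
theorem pairPoly_one :
    (∑ l, (MvPolynomial.X (0 : Fin 2) : MvPolynomial (Fin 2) ℝ) ^ d l •
          ((P l).map (MvPolynomial.C : ℝ →+* MvPolynomial (Fin 2) ℝ)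
            - (MvPolynomial.X (1 : Fin 2) : MvPolynomial (Fin 2) ℝ) •
              (Q l).map (MvPolynomial.C : ℝ →+* MvPolynomial (Fin 2) ℝ))).det =
      ∑ l, (MvPolynomial.X (0 : Fin 2) : MvPolynomial (Fin 2) ℝ) ^ d l *
        (MvPolynomial.C (P l 0 0) - MvPolynomial.X (1 : Fin 2) * MvPolynomial.C (Q l 0 0)) := by
  rw [Matrix.det_fin_one, Matrix.sum_apply]
  refine Finset.sum_congr rfl fun l _ => ?_
  simp [Matrix.smul_apply, Matrix.sub_apply, Matrix.map_apply, smul_eq_mul]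

/-- Evaluation of the scalar pair polynomial: `Φ(x,y) = Σ_l x^{d_l} (p_l − y q_l)`. -/
theorem eval_pairPoly_one (p : Fin 2 → ℝ) :
    MvPolynomial.eval p
        (∑ l, (MvPolynomial.X (0 : Fin 2) : MvPolynomial (Fin 2) ℝ) ^ d l •
          ((P l).map (MvPolynomial.C : ℝ →+* MvPolynomial (Fin 2) ℝ)
            - (MvPolynomial.X (1 : Fin 2) : MvPolynomial (Fin 2) ℝ) •
              (Q l).map (MvPolynomial.C : ℝ →+* MvPolynomial (Fin 2) ℝ))).det =
      ∑ l, p 0 ^ d l * (P l 0 0 - p 1 * Q l 0 0) := by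
  rw [pairPoly_one, map_sum]
  refine Finset.sum_congr rfl fun l _ => ?_
  simp [MvPolynomial.eval_X, MvPolynomial.eval_C]

/-- The Euler derivative `θ_x Φ = X₀ ∂Φ/∂X₀` of the scalar pair polynomial: `Σ_l d_l X₀^{d_l} (p_l − X₁ q_l)`. -/
theorem euler_pairPoly_one :
    MvPolynomial.X 0 * MvPolynomial.pderiv 0
        (∑ l, (MvPolynomial.X (0 : Fin 2) : MvPolynomial (Fin 2) ℝ) ^ d l •
          ((P l).map (MvPolynomial.C : ℝ →+* MvPolynomial (Fin 2) ℝ)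
            - (MvPolynomial.X (1 : Fin 2) : MvPolynomial (Fin 2) ℝ) •
              (Q l).map (MvPolynomial.C : ℝ →+* MvPolynomial (Fin 2) ℝ))).det =
      ∑ l, ((d l : ℝ) • ((MvPolynomial.X (0 : Fin 2) : MvPolynomial (Fin 2) ℝ) ^ d l *
        (MvPolynomial.C (P l 0 0) - MvPolynomial.X (1 : Fin 2) * MvPolynomial.C (Q l 0 0)))) := by
  rw [pairPoly_one, map_sum, Finset.mul_sum]
  refine Finset.sum_congr rfl fun l _ => ?_
  set B : MvPolynomial (Fin 2) ℝ :=
    MvPolynomial.C (P l 0 0) - MvPolynomial.X (1 : Fin 2) * MvPolynomial.C (Q l 0 0) with hB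
  have h1 : MvPolynomial.pderiv (0 : Fin 2) B = 0 := by
    simp [hB, MvPolynomial.pderiv_X_of_ne (show (1 : Fin 2) ≠ 0 by decide)]
  rw [(MvPolynomial.pderiv (0 : Fin 2)).leibniz, h1, smul_zero, zero_add, smul_eq_mul,
    Derivation.leibniz_pow, MvPolynomial.pderiv_X_self]
  rcases Nat.eq_zero_or_pos (d l) with h | h
  · simp [h]
  · obtain ⟨n, hn⟩ : ∃ n, d l = n + 1 := ⟨d l - 1, by omega⟩
    rw [hn]
    simp only [Nat.add_sub_cancel, smul_eq_mul, mul_one, nsmul_eq_mul, Nat.cast_add, Nat.cast_one,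
      MvPolynomial.smul_eq_C_mul, map_add, map_one, map_natCast, pow_succ]
    ring

/-- Evaluation of the Euler derivative: `θ_x Φ(x,y) = Σ_l d_l x^{d_l} (p_l − y q_l)`. -/
theorem eval_euler_pairPoly_one (p : Fin 2 → ℝ) :
    MvPolynomial.eval p (MvPolynomial.X 0 * MvPolynomial.pderiv 0
        (∑ l, (MvPolynomial.X (0 : Fin 2) : MvPolynomial (Fin 2) ℝ) ^ d l •
          ((P l).map (MvPolynomial.C : ℝ →+* MvPolynomial (Fin 2) ℝ)
            - (MvPolynomial.X (1 : Fin 2) : MvPolynomial (Fin 2) ℝ) •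
              (Q l).map (MvPolynomial.C : ℝ →+* MvPolynomial (Fin 2) ℝ))).det) =
      ∑ l, (d l : ℝ) * p 0 ^ d l * (P l 0 0 - p 1 * Q l 0 0) := by
  rw [euler_pairPoly_one, map_sum]
  refine Finset.sum_congr rfl fun l _ => ?_
  simp [MvPolynomial.eval_X, MvPolynomial.eval_C, MvPolynomial.smul_eval, mul_assoc]

/-- The (∑ i, ∑ j, Polynomial.C (((d i : ℝ) - d j) * P i 0 0 * Q j 0 0) * Polynomial.X ^ (d i + d j) : ℝ[X])ONSKIAN `W = θa·c − a·θc = Σ_{i,j} (d_i − d_j) p_i q_j X^{d_i + d_j}` of the scalar pair, evaluated: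
`W(x) = θa(x)·c(x) − a(x)·θc(x)`. -/
theorem eval_wronskian (x : ℝ) :
    (∑ i, ∑ j, Polynomial.C (((d i : ℝ) - d j) * P i 0 0 * Q j 0 0) * Polynomial.X ^ (d i + d j) : ℝ[X]).eval x =
      (∑ l, (d l : ℝ) * x ^ d l * P l 0 0) * (∑ l, x ^ d l * Q l 0 0)
        - (∑ l, x ^ d l * P l 0 0) * (∑ l, (d l : ℝ) * x ^ d l * Q l 0 0) := by
  rw [Polynomial.eval_finsetSum, Finset.sum_mul_sum, Finset.sum_mul_sum, ← Finset.sum_sub_distrib]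
  refine Finset.sum_congr rfl fun i _ => ?_
  rw [Polynomial.eval_finsetSum, ← Finset.sum_sub_distrib]
  refine Finset.sum_congr rfl fun j _ => ?_
  simp only [Polynomial.eval_mul, Polynomial.eval_C, Polynomial.eval_pow, Polynomial.eval_X, pow_add]
  ring

/-- Supports of finite sums of polynomials. [folklore] -/
private theorem support_sum_subset {ι : Type*} [DecidableEq ι] (s : Finset ι) (f : ι → ℝ[X]) :
    (∑ i ∈ s, f i).support ⊆ s.biUnion fun i => (f i).support := by
  induction s using Finset.induction_on with
  | empty => simp
  | insert a s ha ih =>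
      rw [Finset.sum_insert ha, Finset.biUnion_insert]
      exact (Polynomial.support_add).trans (Finset.union_subset_union (le_refl _) ih)

/-- The Wronskian has at most `K²` monomials (its support lies in `{d_i + d_j}`). -/
theorem card_support_wronskian_le :
    (∑ i, ∑ j, Polynomial.C (((d i : ℝ) - d j) * P i 0 0 * Q j 0 0) * Polynomial.X ^ (d i + d j) : ℝ[X]).support.card ≤ K ^ 2 := by
  classical
  have hsub : (∑ i, ∑ j, Polynomial.C (((d i : ℝ) - d j) * P i 0 0 * Q j 0 0) * Polynomial.X ^ (d i + d j) : ℝ[X]).support ⊆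
      (Finset.univ : Finset (Fin K)).biUnion fun i =>
        (Finset.univ : Finset (Fin K)).biUnion fun j => {d i + d j} := by
    refine (support_sum_subset _ _).trans (Finset.biUnion_mono fun i _ => ?_)
    refine (support_sum_subset _ _).trans (Finset.biUnion_mono fun j _ => ?_)
    exact Polynomial.support_C_mul_X_pow_subset _ _
  calc (∑ i, ∑ j, Polynomial.C (((d i : ℝ) - d j) * P i 0 0 * Q j 0 0) * Polynomial.X ^ (d i + d j) : ℝ[X]).support.card
      ≤ ((Finset.univ : Finset (Fin K)).biUnion fun i =>
          (Finset.univ : Finset (Fin K)).biUnion fun j => ({d i + d j} : Finset ℕ)).card :=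
        Finset.card_le_card hsub
    _ ≤ ∑ i : Fin K, ((Finset.univ : Finset (Fin K)).biUnion fun j => ({d i + d j} : Finset ℕ)).card :=
        Finset.card_biUnion_le
    _ ≤ ∑ i : Fin K, ∑ j : Fin K, (({d i + d j} : Finset ℕ)).card :=
        Finset.sum_le_sum fun i _ => Finset.card_biUnion_le
    _ = K ^ 2 := by simp [sq]

variable {d P Q}

/-- `Σ_l x^{d_l} (p_l − y q_l) = a(x) − y·c(x)`. -/
private theorem sum_sub_eq (x y : ℝ) :
    ∑ l, x ^ d l * (P l 0 0 - y * Q l 0 0) = (∑ l, x ^ d l * P l 0 0) - y * ∑ l, x ^ d l * Q l 0 0 := by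
  rw [Finset.mul_sum, ← Finset.sum_sub_distrib]
  refine Finset.sum_congr rfl fun l _ => ?_
  ring

/-- `Σ_l d_l x^{d_l} (p_l − y q_l) = θa(x) − y·θc(x)`. -/
private theorem sum_sub_eq' (x y : ℝ) :
    ∑ l, (d l : ℝ) * x ^ d l * (P l 0 0 - y * Q l 0 0) =
      (∑ l, (d l : ℝ) * x ^ d l * P l 0 0) - y * ∑ l, (d l : ℝ) * x ^ d l * Q l 0 0 := by
  rw [Finset.mul_sum, ← Finset.sum_sub_distrib]
  refine Finset.sum_congr rfl fun l _ => ?_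
  ring

/-- A `K`-nomial with nonnegative coefficients, not all zero, is positive on `(0,∞)`. [folklore] -/
private theorem sum_pow_mul_pos {q : Fin K → ℝ} (hq : ∀ l, 0 ≤ q l) (hs : 0 < ∑ l, q l) {x : ℝ}
    (hx : 0 < x) : 0 < ∑ l, x ^ d l * q l := by
  have hex : ∃ l, 0 < q l := by
    by_contra h
    push Not at h
    have : ∑ l, q l ≤ 0 := Finset.sum_nonpos fun l _ => h l
    linarith
  obtain ⟨l₀, hl₀⟩ := hex
  exact Finset.sum_pos' (fun l _ => mul_nonneg (pow_nonneg hx.le _) (hq l))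
    ⟨l₀, Finset.mem_univ _, mul_pos (pow_pos hx _) hl₀⟩

/-- Membership in the scalar fold set (the line's `foldSet d P Q` at `m = 1`), unfolded:
`x > 0`, `y > 0`, `a(x) = y·c(x)`, `θa(x) = y·θc(x)`. -/
theorem mem_foldSet_one (p : Fin 2 → ℝ) :
    p ∈ {p : Fin 2 → ℝ | 0 < p 0 ∧ 0 < p 1 ∧ MvPolynomial.eval p
          (∑ l, (MvPolynomial.X (0 : Fin 2) : MvPolynomial (Fin 2) ℝ) ^ d l •
          ((P l).map (MvPolynomial.C : ℝ →+* MvPolynomial (Fin 2) ℝ)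
            - (MvPolynomial.X (1 : Fin 2) : MvPolynomial (Fin 2) ℝ) •
              (Q l).map (MvPolynomial.C : ℝ →+* MvPolynomial (Fin 2) ℝ))).det = 0 ∧
        MvPolynomial.eval p (MvPolynomial.X 0 * MvPolynomial.pderiv 0
          (∑ l, (MvPolynomial.X (0 : Fin 2) : MvPolynomial (Fin 2) ℝ) ^ d l •
          ((P l).map (MvPolynomial.C : ℝ →+* MvPolynomial (Fin 2) ℝ)
            - (MvPolynomial.X (1 : Fin 2) : MvPolynomial (Fin 2) ℝ) •
              (Q l).map (MvPolynomial.C : ℝ →+* MvPolynomial (Fin 2) ℝ))).det) = 0} ↔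
    0 < p 0 ∧ 0 < p 1 ∧
      (∑ l, p 0 ^ d l * P l 0 0) - p 1 * (∑ l, p 0 ^ d l * Q l 0 0) = 0 ∧
      (∑ l, (d l : ℝ) * p 0 ^ d l * P l 0 0) - p 1 * (∑ l, (d l : ℝ) * p 0 ^ d l * Q l 0 0) = 0 := by
  simp only [Set.mem_setOf_eq, eval_pairPoly_one, eval_euler_pairPoly_one, sum_sub_eq, sum_sub_eq']

/-- At a fold point of a scalar pair the Wronskian vanishes. -/
theorem eval_wronskian_eq_zero_of_mem {p : Fin 2 → ℝ}
    (hp : p ∈ {p : Fin 2 → ℝ | 0 < p 0 ∧ 0 < p 1 ∧ MvPolynomial.eval p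
          (∑ l, (MvPolynomial.X (0 : Fin 2) : MvPolynomial (Fin 2) ℝ) ^ d l •
          ((P l).map (MvPolynomial.C : ℝ →+* MvPolynomial (Fin 2) ℝ)
            - (MvPolynomial.X (1 : Fin 2) : MvPolynomial (Fin 2) ℝ) •
              (Q l).map (MvPolynomial.C : ℝ →+* MvPolynomial (Fin 2) ℝ))).det = 0 ∧
        MvPolynomial.eval p (MvPolynomial.X 0 * MvPolynomial.pderiv 0
          (∑ l, (MvPolynomial.X (0 : Fin 2) : MvPolynomial (Fin 2) ℝ) ^ d l •
          ((P l).map (MvPolynomial.C : ℝ →+* MvPolynomial (Fin 2) ℝ)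
            - (MvPolynomial.X (1 : Fin 2) : MvPolynomial (Fin 2) ℝ) •
              (Q l).map (MvPolynomial.C : ℝ →+* MvPolynomial (Fin 2) ℝ))).det) = 0}) :
    (∑ i, ∑ j, Polynomial.C (((d i : ℝ) - d j) * P i 0 0 * Q j 0 0) * Polynomial.X ^ (d i + d j) : ℝ[X]).eval (p 0) = 0 := by
  rw [mem_foldSet_one] at hp
  obtain ⟨-, -, h1, h2⟩ := hp
  rw [eval_wronskian]
  have e1 : ∑ l, p 0 ^ d l * P l 0 0 = p 1 * ∑ l, p 0 ^ d l * Q l 0 0 := by linarith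
  have e2 : ∑ l, (d l : ℝ) * p 0 ^ d l * P l 0 0 = p 1 * ∑ l, (d l : ℝ) * p 0 ^ d l * Q l 0 0 := by
    linarith
  rw [e1, e2]
  ring

/-- For a definite scalar pair the fold set is a graph over the `x`-axis (`y = a(x)/c(x)`). -/
theorem injOn_foldSet_one
    (hPQ : (∀ l, (P l).PosSemidef) ∧ (∀ l, (Q l).PosSemidef) ∧ (∑ l, P l).PosDef ∧ (∑ l, Q l).PosDef) :
    Set.InjOn (fun p : Fin 2 → ℝ => p 0) {p : Fin 2 → ℝ | 0 < p 0 ∧ 0 < p 1 ∧ MvPolynomial.eval p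
          (∑ l, (MvPolynomial.X (0 : Fin 2) : MvPolynomial (Fin 2) ℝ) ^ d l •
          ((P l).map (MvPolynomial.C : ℝ →+* MvPolynomial (Fin 2) ℝ)
            - (MvPolynomial.X (1 : Fin 2) : MvPolynomial (Fin 2) ℝ) •
              (Q l).map (MvPolynomial.C : ℝ →+* MvPolynomial (Fin 2) ℝ))).det = 0 ∧
        MvPolynomial.eval p (MvPolynomial.X 0 * MvPolynomial.pderiv 0
          (∑ l, (MvPolynomial.X (0 : Fin 2) : MvPolynomial (Fin 2) ℝ) ^ d l •
          ((P l).map (MvPolynomial.C : ℝ →+* MvPolynomial (Fin 2) ℝ)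
            - (MvPolynomial.X (1 : Fin 2) : MvPolynomial (Fin 2) ℝ) •
              (Q l).map (MvPolynomial.C : ℝ →+* MvPolynomial (Fin 2) ℝ))).det) = 0} := by
  intro p hp p' hp' hpp'
  simp only at hpp'
  rw [mem_foldSet_one] at hp hp'
  obtain ⟨hx, -, h1, -⟩ := hp
  obtain ⟨-, -, h1', -⟩ := hp'
  have hq0 : ∀ l, 0 ≤ Q l 0 0 := fun l => (hPQ.2.1 l).diag_nonneg
  have hqs : 0 < ∑ l, Q l 0 0 := by simpa [Matrix.sum_apply] using hPQ.2.2.2.diag_pos (i := 0)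
  have hc : 0 < ∑ l, p 0 ^ d l * Q l 0 0 := sum_pow_mul_pos hq0 hqs hx
  rw [← hpp'] at h1'
  have hy : p 1 = p' 1 := by
    have : (p 1 - p' 1) * ∑ l, p 0 ^ d l * Q l 0 0 = 0 := by linarith
    rcases mul_eq_zero.mp this with h | h
    · linarith
    · linarith
  funext i
  fin_cases i
  · exact hpp'
  · exact hy

/-- **`stub_rungOne` of line «definite-pair-fold-law»** — statement = the line's `∀ K : ℕ, FoldLawAt 1 K (K ^ 2)`
with `FoldLawAt`, `IsDefinitePair`, `SimpleSpectrum`, `foldSet`, `euler`, `pairPoly` unfolded: for `1 × 1` letters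
the fold number of a definite pair on `K` exponents is at most `K²` (indeed `< K²`).  Descartes' rule on the
Wronskian `θa·c − a·θc`; the simple-spectrum hypothesis is not needed. -/
theorem stub_rungOne :
    ∀ K : ℕ, ∀ (d : Fin K → ℕ) (P Q : Fin K → Matrix (Fin 1) (Fin 1) ℝ),
      ((∀ l, (P l).PosSemidef) ∧ (∀ l, (Q l).PosSemidef) ∧ (∑ l, P l).PosDef ∧ (∑ l, Q l).PosDef) →
      (∀ p : Fin 2 → ℝ, 0 < p 0 →
        MvPolynomial.eval p
          (∑ l, (MvPolynomial.X (0 : Fin 2) : MvPolynomial (Fin 2) ℝ) ^ d l •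
          ((P l).map (MvPolynomial.C : ℝ →+* MvPolynomial (Fin 2) ℝ)
            - (MvPolynomial.X (1 : Fin 2) : MvPolynomial (Fin 2) ℝ) •
              (Q l).map (MvPolynomial.C : ℝ →+* MvPolynomial (Fin 2) ℝ))).det = 0 →
        MvPolynomial.eval p (MvPolynomial.pderiv 1
          (∑ l, (MvPolynomial.X (0 : Fin 2) : MvPolynomial (Fin 2) ℝ) ^ d l •
          ((P l).map (MvPolynomial.C : ℝ →+* MvPolynomial (Fin 2) ℝ)
            - (MvPolynomial.X (1 : Fin 2) : MvPolynomial (Fin 2) ℝ) •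
              (Q l).map (MvPolynomial.C : ℝ →+* MvPolynomial (Fin 2) ℝ))).det) ≠ 0) →
      {p : Fin 2 → ℝ | 0 < p 0 ∧ 0 < p 1 ∧ MvPolynomial.eval p
          (∑ l, (MvPolynomial.X (0 : Fin 2) : MvPolynomial (Fin 2) ℝ) ^ d l •
          ((P l).map (MvPolynomial.C : ℝ →+* MvPolynomial (Fin 2) ℝ)
            - (MvPolynomial.X (1 : Fin 2) : MvPolynomial (Fin 2) ℝ) •
              (Q l).map (MvPolynomial.C : ℝ →+* MvPolynomial (Fin 2) ℝ))).det = 0 ∧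
        MvPolynomial.eval p (MvPolynomial.X 0 * MvPolynomial.pderiv 0
          (∑ l, (MvPolynomial.X (0 : Fin 2) : MvPolynomial (Fin 2) ℝ) ^ d l •
          ((P l).map (MvPolynomial.C : ℝ →+* MvPolynomial (Fin 2) ℝ)
            - (MvPolynomial.X (1 : Fin 2) : MvPolynomial (Fin 2) ℝ) •
              (Q l).map (MvPolynomial.C : ℝ →+* MvPolynomial (Fin 2) ℝ))).det) = 0}.Finite →
      {p : Fin 2 → ℝ | 0 < p 0 ∧ 0 < p 1 ∧ MvPolynomial.eval p
          (∑ l, (MvPolynomial.X (0 : Fin 2) : MvPolynomial (Fin 2) ℝ) ^ d l •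
          ((P l).map (MvPolynomial.C : ℝ →+* MvPolynomial (Fin 2) ℝ)
            - (MvPolynomial.X (1 : Fin 2) : MvPolynomial (Fin 2) ℝ) •
              (Q l).map (MvPolynomial.C : ℝ →+* MvPolynomial (Fin 2) ℝ))).det = 0 ∧
        MvPolynomial.eval p (MvPolynomial.X 0 * MvPolynomial.pderiv 0
          (∑ l, (MvPolynomial.X (0 : Fin 2) : MvPolynomial (Fin 2) ℝ) ^ d l •
          ((P l).map (MvPolynomial.C : ℝ →+* MvPolynomial (Fin 2) ℝ)
            - (MvPolynomial.X (1 : Fin 2) : MvPolynomial (Fin 2) ℝ) •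
              (Q l).map (MvPolynomial.C : ℝ →+* MvPolynomial (Fin 2) ℝ))).det) = 0}.ncard ≤ K ^ 2 := by
  intro K d P Q hPQ _hSS hfin
  classical
  have hp0 : ∀ l, 0 ≤ P l 0 0 := fun l => (hPQ.1 l).diag_nonneg
  have hq0 : ∀ l, 0 ≤ Q l 0 0 := fun l => (hPQ.2.1 l).diag_nonneg
  have hps : 0 < ∑ l, P l 0 0 := by simpa [Matrix.sum_apply] using hPQ.2.2.1.diag_pos (i := 0)
  have hqs : 0 < ∑ l, Q l 0 0 := by simpa [Matrix.sum_apply] using hPQ.2.2.2.diag_pos (i := 0)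
  by_cases hW0 : (∑ i, ∑ j, Polynomial.C (((d i : ℝ) - d j) * P i 0 0 * Q j 0 0) * Polynomial.X ^ (d i + d j) : ℝ[X]) = 0
  · -- `W = 0`: every `(x, a(x)/c(x))`, `x > 0`, is a fold point, so the fold set is infinite.
    exfalso
    refine Set.infinite_of_injOn_mapsTo (s := Set.Ioi (0 : ℝ))
      (f := fun x : ℝ => (![x, (∑ l, x ^ d l * P l 0 0) / (∑ l, x ^ d l * Q l 0 0)] : Fin 2 → ℝ))
      ?_ ?_ (Set.Ioi_infinite 0) hfin
    · intro x _ x' _ hxx'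
      have := congr_fun hxx' 0
      simpa using this
    · intro x hx
      have hx' : (0 : ℝ) < x := hx
      have ha : 0 < ∑ l, x ^ d l * P l 0 0 := sum_pow_mul_pos hp0 hps hx'
      have hc : 0 < ∑ l, x ^ d l * Q l 0 0 := sum_pow_mul_pos hq0 hqs hx'
      have hWx : (∑ l, (d l : ℝ) * x ^ d l * P l 0 0) * (∑ l, x ^ d l * Q l 0 0)
          - (∑ l, x ^ d l * P l 0 0) * (∑ l, (d l : ℝ) * x ^ d l * Q l 0 0) = 0 := by
        rw [← eval_wronskian, hW0, Polynomial.eval_zero]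
      show _ ∈ {p : Fin 2 → ℝ | 0 < p 0 ∧ 0 < p 1 ∧ MvPolynomial.eval p
          (∑ l, (MvPolynomial.X (0 : Fin 2) : MvPolynomial (Fin 2) ℝ) ^ d l •
          ((P l).map (MvPolynomial.C : ℝ →+* MvPolynomial (Fin 2) ℝ)
            - (MvPolynomial.X (1 : Fin 2) : MvPolynomial (Fin 2) ℝ) •
              (Q l).map (MvPolynomial.C : ℝ →+* MvPolynomial (Fin 2) ℝ))).det = 0 ∧
        MvPolynomial.eval p (MvPolynomial.X 0 * MvPolynomial.pderiv 0
          (∑ l, (MvPolynomial.X (0 : Fin 2) : MvPolynomial (Fin 2) ℝ) ^ d l •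
          ((P l).map (MvPolynomial.C : ℝ →+* MvPolynomial (Fin 2) ℝ)
            - (MvPolynomial.X (1 : Fin 2) : MvPolynomial (Fin 2) ℝ) •
              (Q l).map (MvPolynomial.C : ℝ →+* MvPolynomial (Fin 2) ℝ))).det) = 0}
      rw [mem_foldSet_one]
      simp only [Matrix.cons_val_zero, Matrix.cons_val_one]
      refine ⟨hx', div_pos ha hc, ?_, ?_⟩
      · field_simp
        ring
      · rw [div_mul_eq_mul_div, sub_eq_zero, eq_div_iff hc.ne']
        linarith
  · -- `W ≠ 0`: the fold set injects into the positive roots of `W` (sparse Descartes).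
    have hmaps : ∀ p ∈ {p : Fin 2 → ℝ | 0 < p 0 ∧ 0 < p 1 ∧ MvPolynomial.eval p
          (∑ l, (MvPolynomial.X (0 : Fin 2) : MvPolynomial (Fin 2) ℝ) ^ d l •
          ((P l).map (MvPolynomial.C : ℝ →+* MvPolynomial (Fin 2) ℝ)
            - (MvPolynomial.X (1 : Fin 2) : MvPolynomial (Fin 2) ℝ) •
              (Q l).map (MvPolynomial.C : ℝ →+* MvPolynomial (Fin 2) ℝ))).det = 0 ∧
        MvPolynomial.eval p (MvPolynomial.X 0 * MvPolynomial.pderiv 0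
          (∑ l, (MvPolynomial.X (0 : Fin 2) : MvPolynomial (Fin 2) ℝ) ^ d l •
          ((P l).map (MvPolynomial.C : ℝ →+* MvPolynomial (Fin 2) ℝ)
            - (MvPolynomial.X (1 : Fin 2) : MvPolynomial (Fin 2) ℝ) •
              (Q l).map (MvPolynomial.C : ℝ →+* MvPolynomial (Fin 2) ℝ))).det) = 0},
        (fun p : Fin 2 → ℝ => p 0) p ∈
          (↑((∑ i, ∑ j, Polynomial.C (((d i : ℝ) - d j) * P i 0 0 * Q j 0 0) * Polynomial.X ^ (d i + d j) : ℝ[X]).roots.toFinset.filter (fun t => 0 < t)) : Set ℝ) := by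
      intro p hp
      have hx : 0 < p 0 := ((mem_foldSet_one p).mp hp).1
      simp only [Finset.coe_filter, Set.mem_setOf_eq, Multiset.mem_toFinset]
      exact ⟨(Polynomial.mem_roots hW0).mpr (eval_wronskian_eq_zero_of_mem hp), hx⟩
    calc {p : Fin 2 → ℝ | 0 < p 0 ∧ 0 < p 1 ∧ MvPolynomial.eval p
          (∑ l, (MvPolynomial.X (0 : Fin 2) : MvPolynomial (Fin 2) ℝ) ^ d l •
          ((P l).map (MvPolynomial.C : ℝ →+* MvPolynomial (Fin 2) ℝ)
            - (MvPolynomial.X (1 : Fin 2) : MvPolynomial (Fin 2) ℝ) •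
              (Q l).map (MvPolynomial.C : ℝ →+* MvPolynomial (Fin 2) ℝ))).det = 0 ∧
        MvPolynomial.eval p (MvPolynomial.X 0 * MvPolynomial.pderiv 0
          (∑ l, (MvPolynomial.X (0 : Fin 2) : MvPolynomial (Fin 2) ℝ) ^ d l •
          ((P l).map (MvPolynomial.C : ℝ →+* MvPolynomial (Fin 2) ℝ)
            - (MvPolynomial.X (1 : Fin 2) : MvPolynomial (Fin 2) ℝ) •
              (Q l).map (MvPolynomial.C : ℝ →+* MvPolynomial (Fin 2) ℝ))).det) = 0}.ncard
        ≤ (↑((∑ i, ∑ j, Polynomial.C (((d i : ℝ) - d j) * P i 0 0 * Q j 0 0) * Polynomial.X ^ (d i + d j) : ℝ[X]).roots.toFinset.filter (fun t => 0 < t)) : Set ℝ).ncard :=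
          Set.ncard_le_ncard_of_injOn _ hmaps (injOn_foldSet_one hPQ) (Finset.finite_toSet _)
      _ = ((∑ i, ∑ j, Polynomial.C (((d i : ℝ) - d j) * P i 0 0 * Q j 0 0) * Polynomial.X ^ (d i + d j) : ℝ[X]).roots.toFinset.filter (fun t => 0 < t)).card := Set.ncard_coe_finset _
      _ ≤ K ^ 2 := by
          have h1 :=
            Literature.Computability.AlgebraicComplexity.card_roots_toFinset_filter_pos_lt_card_support hW0
          have h2 := card_support_wronskian_le d P Q
          omega

end RungOne

end Summit.ValiantsHypothesis.ValiantsHypothesis.Theorems.LacunarySymmetroidMatrixDescartes.FoldLaw
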